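import Summits.CriticalPhenomena.PercolationContinuityZ3.Theorems.PercNearOneGluingNoHeavyQuantFarTreeBlockCombCanonical
import HarnessLib

/-!
# QUANT lane R8, FAR on trees: the BLOCK-COMB ROW typed in the provers' coordinates (`Quant.BlockComb.StaircaseRow`, crossing form of the
# canonical model) and its transport to `Quant.FarTreeRow` / `Quant.FarRelayRow`

builds on p205010 (kernel theorem, internal audit signed; external expert review pending)

Support file (`--supports stmt-CriticalPhenomena-4575`), QUANT lane typer seat prim-quant-stmt (gen 15), rung R8 of
`run/shared/lean/prim/quant/LADDER.md`.  Theorems only (the row is carried as an explicit HYPOTHESIS written out in crossing form — the named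
`@[conjecture] def Quant.BlockComb.StaircaseRow` with the same body is left to a planner/lead: definition-kind files under `Theorems/` are not
accepted from this seat); no sorries; standard axioms.

After the class `|A|·x > 2j` (`Quant.farTree_blockComb_of_classBudget`, `…QuantFarTreeBlockCombCanonical.lean`; canonical model: lead g12's
`Quant.BlockComb.tail_ge_of_class`, p1 g8's `Quant.BlockComb.tail_ge_of_le_marg_strong`) the ONE open block-comb regime of `Quant.FarTreeRow` is
BUDGET-BINDING (`|A|·x ≤ 2j < EN`; LEAD-NOTES-G10 N21 (6), lead g12 lane INBOX 2026-08-21T01:25Z (2): normal form of a minimal counterexample, "the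
general row is an LP over STAIRCASES — chain weights non-increasing — not over the marginal box").  The R8 provers now work in p1 g8's canonical
model; this file types their target ONCE, in the crossing form that the transport `Quant.farTree_blockComb_heavy_ge_of_crossing` consumes, so that
partial families land against one statement and reach the tree row with no further work:

* THE ROW (hypothesis `hS` of the three theorems; to be typed as `Quant.BlockComb.StaircaseRow`) — **the block-comb row, canonical coordinates (OPEN).**  Blobs `0, …, M−1` listed root-first with sizes `sz k`,
  private gates `p k ∈ [0,1]` and chain weights `W k = ∏_{i≤k} qc i` (`qc i ∈ [0,1]`: an arbitrary NON-INCREASING staircase `W 0 ≥ W 1 ≥ ⋯`); if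
  `x ≤ W k · p k` for every live blob and `2j < Σ_k sz k · W k · p k` (the mean), then `x ≤ Σ_k W k · p k · (CB[sz,p,k] j − CB[sz,p,k](j − sz k))`
  (`= P(N ≥ j+1)` by `Quant.blockComb_count_eq` / `Quant.BlockComb.tail_eq_crossing`).  KERNEL SUB-CASES: `2j < (Σ sz)·p k` for all live `k`
  (`Quant.BlockComb.le_crossing_of_le_marg_strong`), `2j < (Σ sz)·x` (`Quant.BlockComb.le_crossing_of_class`), equal private gates
  (`BlobWalk.exchange_of_const'`), bottom room / top room (`BlobWalk.exchange_of_bottomRoom` / `exchange_of_topRoom`, via the exchange identity).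
  It is IMPLIED by `Quant.FarTreeRow` (realise the datum as gates: a chain of `M` gates `qc`, blob `k` = `sz k` relays behind one private gate
  `p k` — p1 g8's `…QuantFarTreeBlockCombStrong.lean` setting; not formalised in this direction here), so nothing stronger than FAR is asserted.
  Evidence: lead g12's exact engine (README V144: > 8 000 climbed budget-binding instances, exact rational re-decision, 0 violations; infimum 0 only
  along glue), and every census of `Quant.FarTreeRow` (CENSUS-GAIN §14).  Refuted relaxations (do not retype): the marginal-box LP without the
  chain order ((EX-free), lead g12), (TW)/(PW)/(SMS)/(FO′-any-order) (`…QuantBlobWindowFalse.lean`).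
* `Quant.farTree_blockComb_of_staircaseRow` — **transport**: the row ⟹ `Quant.FarTreeRow`'s conclusion for EVERY block-comb (ancestor finsets
  with the forest axioms, relays `A ∋ a` with `a` least likely, comb condition `P b ≠ P b' → P b ∩ P b' ⊆ P a`, mean `2j < Σ_{b∈A} ∏_{P b} q`,
  cut `1 − ∏_{P a} q ≤ t`).  `Quant.farTree_blockComb_of_staircaseRow_essential`, `Quant.farRelayRow_tree_blockComb_of_staircaseRow` — essential
  ancestor sets; route vocabulary (`o ∉ A`; the body of `Quant.FarRelayRow` for tree-supported weights whose relays form a block-comb).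
[cite: KozmaNitzan2024, Conjecture 3 (p. 15)] (the gluing rows served); [this work].
-/

noncomputable section

namespace Summit.CriticalPhenomena.PercolationContinuityZ3.Theorems

namespace Quant

open Finset MeasureTheory
open Literature.Probability.LatticeModels
open Literature.Probability.Percolation
open scoped Classical

/-- `CB[a, p, m] t` = probability that the open mass of the first `m` blobs (sizes `a`, gates `p`) is `≤ t` (the recursion of
`…QuantBlobWalk.lean`, verbatim). -/
local notation3 "CB[" a ", " p ", " m "]" =>
  (Nat.rec (motive := fun _ => ℤ → ℝ) (fun t => if (0 : ℤ) ≤ t then (1 : ℝ) else 0)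
    (fun n f t => (p : ℕ → ℝ) n * f (t - ((a : ℕ → ℕ) n : ℤ)) + (1 - (p : ℕ → ℝ) n) * f t) (m : ℕ))


variable {ι : Type*} [Fintype ι] [DecidableEq ι]

/-- **Transport: the block-comb row in canonical (crossing) coordinates ⟹ `Quant.FarTreeRow`'s conclusion for every block-comb.**  The hypothesis
`hS` is the row: for every levelled canonical datum (chain gates `qc i ∈ [0,1]`, sizes `sz`, private gates `p ∈ [0,1]`), `x ≤` every live marginal and
`2j < Σ_k sz k·W k·p k` imply `x ≤ Σ_k W k p k (CB[sz,p,k] j − CB[sz,p,k](j − sz k))` (`W k = ∏_{i≤k} qc i`).  Ancestor finsets `P` of a rooted forest (`y ∈ P x → P y ⊆ P x`;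
members of `P x` pairwise comparable), gates `q`, relays `A ∋ a` with `a` least likely, BLOCK-COMB around `a` (`P b ≠ P b' → P b ∩ P b' ⊆ P a` on `A`),
mean `2j < Σ_{b∈A} ∏_{P b} q`; then `1 − ∏_{P a} q ≤ t` gives `P(#{b ∈ A : ↑(P b) ⊆ ω} ≤ j) ≤ t`. [this work] -/
theorem farTree_blockComb_of_staircaseRow
    (hS : ∀ (M : ℕ) (qc : ℕ → ℝ) (sz : ℕ → ℕ) (p : ℕ → ℝ) (j : ℕ) (x : ℝ),
      (∀ i, 0 ≤ qc i ∧ qc i ≤ 1) → (∀ k, 0 ≤ p k ∧ p k ≤ 1) →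
      (∀ k, k < M → 0 < sz k → x ≤ (∏ i ∈ Finset.range (k + 1), qc i) * p k) →
      (2 * j : ℝ) < ∑ k ∈ Finset.range M, (sz k : ℝ) * ((∏ i ∈ Finset.range (k + 1), qc i) * p k) →
      x ≤ ∑ k ∈ Finset.range M, (∏ i ∈ Finset.range (k + 1), qc i) * p k *
        (CB[sz, p, k] (j : ℤ) - CB[sz, p, k] ((j : ℤ) - (sz k : ℤ))))
    (P : ι → Finset ι)
    (h2 : ∀ x, ∀ y ∈ P x, P y ⊆ P x) (h3 : ∀ x, ∀ y ∈ P x, ∀ z ∈ P x, y ∈ P z ∨ z ∈ P y)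
    (q : ι → unitInterval) (A : Finset ι) (j : ℕ) (t : ℝ) (a : ι) (ha : a ∈ A)
    (hmin : ∀ b ∈ A, ∏ y ∈ P a, (q y : ℝ) ≤ ∏ y ∈ P b, (q y : ℝ))
    (hcomb : ∀ b ∈ A, ∀ b' ∈ A, P b ≠ P b' → P b ∩ P b' ⊆ P a)
    (hEN : (2 * j : ℝ) < ∑ b ∈ A, ∏ y ∈ P b, (q y : ℝ))
    (ht : 1 - ∏ y ∈ P a, (q y : ℝ) ≤ t) :
    (prodBernoulli q).real {ω : Set ι | (A.filter fun b => ((P b : Finset ι) : Set ι) ⊆ ω).card ≤ j} ≤ t := by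
  have hmeas : ∀ T : Set (Set ι), MeasurableSet T := fun T => (Set.toFinite T).measurableSet
  have hheavy : ∏ y ∈ P a, (q y : ℝ) ≤ (prodBernoulli q).real
      {ω : Set ι | (j : ℤ) + 1 ≤ (((A.filter fun y => ((P y : Finset ι) : Set ι) ⊆ ω).card : ℕ) : ℤ)} := by
    refine farTree_blockComb_heavy_ge_of_crossing P h2 h3 q A a ha hcomb j _
      fun M qc sz p cls hqc hp _ _ _ hreal _ _ hENid => ?_
    refine hS M qc sz p j _ hqc hp (fun k hk _ => ?_) (by rw [hENid]; exact hEN)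
    obtain ⟨b, hb, _, _, _, _, hmarg⟩ := hreal k hk
    rw [hmarg]; exact hmin b hb
  rw [blockComb_light_eq_compl P A j, probReal_compl_eq_one_sub (hmeas _)]
  linarith

/-- **Transport on the ESSENTIAL ancestor sets** `{y ∈ P x | q y ≠ 1}` (glued classes as weight-one paths; `hS` = the row as above). [this work] -/
theorem farTree_blockComb_of_staircaseRow_essential
    (hS : ∀ (M : ℕ) (qc : ℕ → ℝ) (sz : ℕ → ℕ) (p : ℕ → ℝ) (j : ℕ) (x : ℝ),
      (∀ i, 0 ≤ qc i ∧ qc i ≤ 1) → (∀ k, 0 ≤ p k ∧ p k ≤ 1) →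
      (∀ k, k < M → 0 < sz k → x ≤ (∏ i ∈ Finset.range (k + 1), qc i) * p k) →
      (2 * j : ℝ) < ∑ k ∈ Finset.range M, (sz k : ℝ) * ((∏ i ∈ Finset.range (k + 1), qc i) * p k) →
      x ≤ ∑ k ∈ Finset.range M, (∏ i ∈ Finset.range (k + 1), qc i) * p k *
        (CB[sz, p, k] (j : ℤ) - CB[sz, p, k] ((j : ℤ) - (sz k : ℤ))))
    {m : ℕ} (P : Fin m → Finset (Fin m))
    (h2 : ∀ x, ∀ y ∈ P x, P y ⊆ P x) (h3 : ∀ x, ∀ y ∈ P x, ∀ z ∈ P x, y ∈ P z ∨ z ∈ P y)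
    (q : Fin m → unitInterval) (A : Finset (Fin m)) (j : ℕ) (t : ℝ) (a : Fin m) (ha : a ∈ A)
    (hmin : ∀ b ∈ A, ∏ y ∈ P a, (q y : ℝ) ≤ ∏ y ∈ P b, (q y : ℝ))
    (hcomb : ∀ b ∈ A, ∀ b' ∈ A, (P b).filter (fun y => q y ≠ 1) ≠ (P b').filter (fun y => q y ≠ 1) →
      (P b).filter (fun y => q y ≠ 1) ∩ (P b').filter (fun y => q y ≠ 1) ⊆ (P a).filter (fun y => q y ≠ 1))
    (hEN : (2 * j : ℝ) < ∑ b ∈ A, ∏ y ∈ P b, (q y : ℝ))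
    (ht : 1 - ∏ y ∈ P a, (q y : ℝ) ≤ t) :
    (prodBernoulli q).real {ω : Set (Fin m) | (A.filter fun b => ((P b : Finset (Fin m)) : Set (Fin m)) ⊆ ω).card ≤ j} ≤ t := by
  rw [light_real_eq_essential q P A j]
  obtain ⟨h2', h3'⟩ := essential_axioms q P h2 h3
  have hprod : ∀ b, ∏ y ∈ (P b).filter (fun y => q y ≠ 1), (q y : ℝ) = ∏ y ∈ P b, (q y : ℝ) :=
    fun b => prod_filter_ne_one_eq q (P b)
  refine farTree_blockComb_of_staircaseRow hS (fun x => (P x).filter fun y => q y ≠ 1) h2' h3' q A j t a ha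
    (fun b hb => by rw [hprod, hprod]; exact hmin b hb) hcomb ?_ (by rw [hprod]; exact ht)
  rw [Finset.sum_congr rfl fun b _ => hprod b]; exact hEN

/-- **Transport, route vocabulary (`o ∉ A`): the row (`hS`) ⟹ the body of `Quant.FarRelayRow` for tree-supported weights whose relays form a
block-comb.**  Weights on the pairs of `Fin n` supported on a rooted spanning tree (`par`/`depth` coordinates; weight `0` prunes); ESSENTIAL ancestor
sets `E b`; relays `A ∌ o` with a least likely `a`, combed around `a` (`E b ≠ E b' → E b ∩ E b' ⊆ E a` on `A`); then `2j < Σ_{b∈A} P(o ↔ b)` and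
`P(o ↮ b) ≤ t` on `A` give `P(#{b ∈ A | o ↔ b} ≤ j) ≤ t`. [this work] -/
theorem farRelayRow_tree_blockComb_of_staircaseRow
    (hS : ∀ (M : ℕ) (qc : ℕ → ℝ) (sz : ℕ → ℕ) (p : ℕ → ℝ) (j : ℕ) (x : ℝ),
      (∀ i, 0 ≤ qc i ∧ qc i ≤ 1) → (∀ k, 0 ≤ p k ∧ p k ≤ 1) →
      (∀ k, k < M → 0 < sz k → x ≤ (∏ i ∈ Finset.range (k + 1), qc i) * p k) →
      (2 * j : ℝ) < ∑ k ∈ Finset.range M, (sz k : ℝ) * ((∏ i ∈ Finset.range (k + 1), qc i) * p k) →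
      x ≤ ∑ k ∈ Finset.range M, (∏ i ∈ Finset.range (k + 1), qc i) * p k *
        (CB[sz, p, k] (j : ℤ) - CB[sz, p, k] ((j : ℤ) - (sz k : ℤ))))
    (n : ℕ) (w : Sym2 (Fin n) → unitInterval) (o : Fin n)
    (depth : Fin n → ℕ) (par : Fin n → Fin n)
    (hroot : ∀ x, x ≠ o → depth x = 0 → par x = o)
    (hstep : ∀ x, x ≠ o → depth x ≠ 0 → par x ≠ o ∧ depth (par x) + 1 = depth x)
    (hsupp : ∀ e, w e ≠ 0 → e.IsDiag ∨ ∃ x, x ≠ o ∧ e = s(par x, x))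
    (E : Fin n → Finset (Fin n))
    (hE : ∀ b, b ≠ o → E b = ((Finset.range (depth b + 1)).image (fun i => par^[i] b)).filter fun y => w s(par y, y) ≠ 1)
    (A : Finset (Fin n)) (hoA : o ∉ A) (a : Fin n) (ha : a ∈ A)
    (hmin : ∀ b ∈ A, (prodBernoulli w).real (openConn o a) ≤ (prodBernoulli w).real (openConn o b))
    (hcomb : ∀ b ∈ A, ∀ b' ∈ A, E b ≠ E b' → E b ∩ E b' ⊆ E a)
    (j : ℕ) (hEN : (2 * j : ℝ) < ∑ b ∈ A, (prodBernoulli w).real (openConn o b))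
    (t : ℝ) (ht : ∀ b ∈ A, (prodBernoulli w).real (openConn o b : Set (BondConfig (Fin n)))ᶜ ≤ t) :
    (prodBernoulli w).real {ω : BondConfig (Fin n) | (A.filter fun b => ω ∈ openConn o b).card ≤ j} ≤ t := by
  have hAo : ∀ b ∈ A, b ≠ o := fun b hb hbo => hoA (hbo ▸ hb)
  refine farRelayRow_tree_of_gate n w o depth par hroot hstep hsupp A hoA j t fun q P hq hqo hP h1 h2 h3 hmarg => ?_
  have hPE : ∀ b ∈ A, (P b).filter (fun y => q y ≠ 1) = E b := by
    intro b hb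
    have hbo := hAo b hb
    rw [hE b hbo, hP b hbo]
    refine Finset.filter_congr fun y hy => ?_
    rw [hq y (tree_mem_ancestors_ne_root o depth par hstep b hbo y hy)]
  refine farTree_blockComb_of_staircaseRow_essential hS P h2 h3 q A j t a ha ?_ ?_ ?_ ?_
  · intro b hb; rw [hmarg a (hAo a ha), hmarg b (hAo b hb)]; exact hmin b hb
  · intro b hb b' hb'
    rw [hPE b hb, hPE b' hb', hPE a ha]
    exact hcomb b hb b' hb'
  · rw [Finset.sum_congr rfl fun b hb => hmarg b (hAo b hb)]; exact hEN
  · rw [hmarg a (hAo a ha), ← probReal_compl_eq_one_sub (Set.toFinite _).measurableSet]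
    exact ht a ha

end Quant

end Summit.CriticalPhenomena.PercolationContinuityZ3.Theorems

end
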